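import Literature.AlgebraicGeometry.Motives.LangWeilEstimateOfRiemannHypothesis
import Literature.AlgebraicGeometry.Motives.ZetaFunctionPoleOrderTateConjecture
import HarnessLib

/-!
# Frobenius is `qʳ` on algebraic classes: traces with algebraic part, polynomial point counts, and
# Deligne's estimate (8.1) for varieties whose off-middle cohomology is algebraic

Topic `Literature/AlgebraicGeometry/Motives`; THEOREMS ONLY (no definition, no instance, no named
fact; D-0026).  Sequel of `Motives/LangWeilEstimateOfRiemannHypothesis` (row g41-#3) for the tree's
abstract Galois Weil cohomology theory `E : GaloisWeilCohomology k K χ` over a finite field `k` (`q = #k`,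
`χ(φ) = q`), `X` smooth projective of dimension `d`, `bᵢ = dim_K Hⁱ(X)`,
`aᵣ = dim_K (K·Aʳ(X))` the rank of the span of the codimension-`r` algebraic classes in `H^{2r}(X)`.

P. Deligne, *La conjecture de Weil. I* [Deligne1974], Th. (8.1) and its proof (pp. 301–302): «Soit
`Q_ℓ·ηⁱ` la droite dans `H^{2i}(X, Q_ℓ)` engendrée par la `i`-ième cup-puissance de la classe de cohomologie
d'une section hyperplane.  Sur cette droite, `F*` agit par multiplication par `qⁱ`.  La cohomologie de `X`
est somme des `Q_ℓ·ηⁱ` (`0 ≤ i ≤ n`) et de la partie primitive de `Hⁿ(X, Q_ℓ)`, de dimension `b`.  D'après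
(1.5), il existe donc `b` nombres algébriques `αⱼ` … tels que `#X(𝔽_q) = Σ_{i=0}^{n} qⁱ + (−1)ⁿ Σⱼ αⱼ`.
D'après (1.7), `|αⱼ| = q^{n/2}` et `|#X(𝔽_q) − #ℙⁿ(𝔽_q)| = |Σⱼ αⱼ| ≤ b·q^{n/2}`» — with `b = b′` for `n`
odd and `b = b′ − 1` for `n` even.  Here the hyperplane-power lines are replaced by the span of ALL
algebraic classes, on which the twisted Galois action is trivial (Tate 1994, §1; the tree's
`algebraicClasses_le_invariants`), so that `F = qʳ` there.

* §1 (no Riemann hypothesis) `frobAction_apply_of_mem_algebraicClasses` (**`F a = qʳ a`** for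
  `a ∈ K·Aʳ(X) ⊆ H^{2r}(X)`); when `K·Aʳ(X) = H^{2r}(X)`: `frobAction_eq_smul_one_of_algebraicClasses_eq_top`,
  **`frobTracePow_of_algebraicClasses_eq_top` (`tr(Fᵐ | H^{2r}) = b_{2r} q^{rm}`)**,
  **`frobCharPoly_of_algebraicClasses_eq_top` (`P_{2r}(T) = (1 − qʳT)^{b_{2r}}`)**.
* §2 (Riemann hypothesis) **`exists_int_frobTracePow_sub_le`: `tr(Fᵐ | H^{2r}(X)) = t ∈ ℤ` with
  `|t − aᵣ q^{rm}| ≤ (b_{2r} − aᵣ) q^{rm}`** — `aᵣ` of the `b_{2r}` reciprocal roots of `P_{2r}` equal `qʳ`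
  (the tree's `finrank_algebraicClasses_le_rootMultiplicity_frobCharPoly`, Milne 1986 Prop. 8.2), the
  others have absolute value `qʳ`.
* §3 (point counts; `E` satisfies the Lefschetz trace formula) **`pointCount_eq_sum_of_algebraic`:
  `#X(𝔽_{q^m}) = Σ_{r=0}^{d} b_{2r} q^{rm}` EXACTLY** when every `H^{2r}(X)` is spanned by algebraic classes
  and the odd Betti numbers vanish (no Riemann hypothesis needed — Weil's «Grassmannian test», Kahn 2020
  §3.3); **`abs_pointCount_sub_sum_le_of_odd`** (Deligne (8.1), `d` odd: off the middle degree the odd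
  cohomology vanishes and the even cohomology is algebraic ⟹ `|#X(𝔽_{q^m}) − Σ_{r=0}^{d} b_{2r} q^{rm}| ≤
  b_d q^{dm/2}`); **`abs_pointCount_sub_sum_le_of_even`** (Deligne (8.1), `d = 2c` even:
  `|#X(𝔽_{q^m}) − Σ_{r ≠ c} b_{2r} q^{rm} − a_c q^{cm}| ≤ (b_d − a_c) q^{cm}`, Deligne's `b = b′ − 1` being the
  case `a_c = 1`, `b_{2r} = 1`).

HC is not touched.

## References

* [Deligne1974] P. Deligne, *La conjecture de Weil. I*, Publ. Math. IHÉS 43 (1974), Th. (8.1), pp. 301–302;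
  Th. (1.6); (2.5).
* [Tate1994] J. Tate, *Conjectures on algebraic cycles in ℓ-adic cohomology*, PSPM 55 (1994), §1.
* [Milne1986ValuesZetaFunctionsFiniteFields] J. S. Milne, *Values of zeta functions of varieties over
  finite fields*, Amer. J. Math. 108 (1986), §8 Prop. 8.2.
* [Kahn2020] B. Kahn, *Zeta and L-functions of varieties and motives* (2020), §3.3 (Weil's tests on
  Grassmannians, «cellular» varieties), Exercise 3.40.
* [Poonen2017] B. Poonen, *Rational points on varieties*, GSM 186 (2017), Th. 7.1.1 (ii).

## Provenance

Lane `lit-hodgefound` (summit `HodgeConjecture`, Track 2 foundations library, Layer B: motives / zeta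
functions), seat `lit-hodgefound-p29` (literature-prover, generation 41, row g41-#4).
-/

noncomputable section

open Polynomial Filter

universe u v

namespace Literature.AlgebraicGeometry.Motives

namespace GaloisWeilCohomology

open Literature.NumberTheory.LFunctions (WeilFunctionalEquation.reverse_X_sub_C_eq)
open Literature.NumberTheory.LFunctions.WeilEstimate (intCast_coeff_logDerivInt_eq_sum_roots)

variable {k : Type u} [Field k] [Finite k] {K : Type v} [Field K] [CharZero K]
  {χ : Field.absoluteGaloisGroup k →* Kˣ} (E : GaloisWeilCohomology k K χ)
variable {d : ℕ} {X : SchemeOver k}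

/-! ### §1 `F = qʳ` on the algebraic classes of `H^{2r}(X)` -/

/-- **`F a = qʳ · a` for every algebraic class `a ∈ K·Aʳ(X) ⊆ H^{2r}(X)`**: the twisted action
`χ(g)ʳ g` fixes the classes of algebraic cycles (Tate 1994, §1; axiom `cycleClass_ρ`), and
`χ(φ⁻¹)ʳ = q^{−r}` (Deligne 1974, proof of (8.1): «sur cette droite, `F*` agit par multiplication par `qⁱ`»).
[cite: Deligne1974, Th. (8.1) proof p. 301] [cite: Tate1994, §1] -/
theorem frobAction_apply_of_mem_algebraicClasses (hχ : ((χ (arithFrob k) : Kˣ) : K) = Nat.card k)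
    (hX : IsSmoothProjective d X) {r : ℕ} {a : E.obj X (2 * r)} (ha : a ∈ E.algebraicClasses X r) :
    E.frobAction X (2 * r) a = ((Nat.card k : K) ^ r) • a := by
  have h := (Representation.mem_invariants (E.ρTwist X (2 * r) r) a).mp
    (E.algebraicClasses_le_invariants hX r ha) (geomFrob k)
  rw [ρTwist_apply, coe_χ_geomFrob hχ, zpow_natCast, inv_pow, ← frobAction_def] at h
  have hq : (Nat.card k : K) ^ r ≠ 0 := pow_ne_zero _ (Nat.cast_ne_zero.mpr Nat.card_pos.ne')
  calc E.frobAction X (2 * r) a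
      = ((Nat.card k : K) ^ r) • ((((Nat.card k : K) ^ r)⁻¹) • E.frobAction X (2 * r) a) := by
        rw [smul_smul, mul_inv_cancel₀ hq, one_smul]
    _ = ((Nat.card k : K) ^ r) • a := by rw [h]

/-- **If `H^{2r}(X)` is spanned by algebraic classes then `F | H^{2r}(X) = qʳ · 1`.**
[cite: Deligne1974, Th. (8.1) proof p. 301] [cite: Tate1994, §1] -/
theorem frobAction_eq_smul_one_of_algebraicClasses_eq_top
    (hχ : ((χ (arithFrob k) : Kˣ) : K) = Nat.card k) (hX : IsSmoothProjective d X) {r : ℕ}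
    (htop : E.algebraicClasses X r = ⊤) :
    E.frobAction X (2 * r) = ((Nat.card k : K) ^ r) • (1 : Module.End K (E.obj X (2 * r))) :=
  LinearMap.ext fun a => by
    rw [LinearMap.smul_apply, Module.End.one_apply]
    exact E.frobAction_apply_of_mem_algebraicClasses hχ hX (htop ▸ Submodule.mem_top)

/-- **`tr(Fᵐ | H^{2r}(X)) = b_{2r} · q^{rm}` when `H^{2r}(X)` is spanned by algebraic classes** (every
`m`; Deligne 1974, proof of (8.1): the algebraic lines contribute `Σ qⁱ` to `#X(𝔽_q)`).
[cite: Deligne1974, Th. (8.1) proof pp. 301–302] -/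
theorem frobTracePow_of_algebraicClasses_eq_top (hχ : ((χ (arithFrob k) : Kˣ) : K) = Nat.card k)
    (hX : IsSmoothProjective d X) {r : ℕ} (htop : E.algebraicClasses X r = ⊤) (m : ℕ) :
    E.frobTracePow X (2 * r) m = Module.finrank K (E.obj X (2 * r)) * (Nat.card k : K) ^ (r * m) := by
  haveI := E.finite_obj hX (2 * r)
  rw [frobTracePow, E.frobAction_eq_smul_one_of_algebraicClasses_eq_top hχ hX htop, _root_.smul_pow,
    one_pow, map_smul, LinearMap.trace_one, smul_eq_mul, ← pow_mul, mul_comm]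

omit [Finite k] [CharZero K] in
/-- The characteristic polynomial of a scalar: `charpoly (c · 1) = (T − c)^{dim V}`. [folklore] -/
private theorem charpoly_smul_one {V : Type*} [AddCommGroup V] [Module K V] [FiniteDimensional K V]
    (c : K) : (c • (1 : Module.End K V)).charpoly = (Polynomial.X - C c) ^ Module.finrank K V := by
  have h := LinearMap.charpoly_sub_smul (0 : Module.End K V) (-c)
  rw [zero_sub, neg_smul, neg_neg, LinearMap.charpoly_zero, X_pow_comp, C_neg, ← sub_eq_add_neg] at h
  exact h

omit [Finite k] [CharZero K] in
/-- `reverse ((T − c)ⁿ) = (1 − cT)ⁿ`. [folklore] -/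
private theorem reverse_X_sub_C_pow (c : K) (n : ℕ) :
    ((Polynomial.X - C c) ^ n).reverse = (1 - C c * Polynomial.X) ^ n := by
  induction n with
  | zero => rw [pow_zero, pow_zero, ← C_1, reverse_C]
  | succ n ih => rw [pow_succ, reverse_mul_of_domain, ih, WeilFunctionalEquation.reverse_X_sub_C_eq,
      pow_succ]

/-- **`P_{2r}(X, T) = det(1 − T·F | H^{2r}(X)) = (1 − qʳT)^{b_{2r}}` when `H^{2r}(X)` is spanned by
algebraic classes** (all `b_{2r}` reciprocal roots equal `qʳ`). [cite: Deligne1974, Th. (8.1) proof p. 301]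
[cite: Milne1986ValuesZetaFunctionsFiniteFields, §8 Prop. 8.2] -/
theorem frobCharPoly_of_algebraicClasses_eq_top (hχ : ((χ (arithFrob k) : Kˣ) : K) = Nat.card k)
    (hX : IsSmoothProjective d X) {r : ℕ} (htop : E.algebraicClasses X r = ⊤) :
    E.frobCharPoly X (2 * r) =
      (1 - C ((Nat.card k : K) ^ r) * Polynomial.X) ^ Module.finrank K (E.obj X (2 * r)) := by
  haveI := E.finite_obj hX (2 * r)
  rw [E.frobCharPoly_of_finite, E.frobAction_eq_smul_one_of_algebraicClasses_eq_top hχ hX htop,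
    charpoly_smul_one, reverse_X_sub_C_pow]

/-! ### §2 Traces on `H^{2r}(X)` and their algebraic part, under the Riemann hypothesis -/

omit [Finite k] [CharZero K] in
/-- Power sums over a multiset of complex numbers of common absolute value `ρ⁻¹`:
`|Σ_z z^{−m}| ≤ #s · ρᵐ`. [folklore] -/
private theorem norm_multiset_sum_inv_pow_le {s : Multiset ℂ} {ρ : ℝ} (hs : ∀ z ∈ s, ‖z‖ = ρ⁻¹)
    (m : ℕ) : ‖(s.map fun z => z⁻¹ ^ m).sum‖ ≤ Multiset.card s * ρ ^ m := by
  calc ‖(s.map fun z => z⁻¹ ^ m).sum‖ ≤ (s.map fun z => ‖z⁻¹ ^ m‖).sum := by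
        simpa [Multiset.map_map] using norm_multiset_sum_le (s.map fun z => z⁻¹ ^ m)
    _ = (s.map fun _ => ρ ^ m).sum := by
        refine congr_arg _ (Multiset.map_congr rfl fun z hz => ?_)
        rw [norm_pow, norm_inv, hs z hz, inv_inv]
    _ = Multiset.card s * ρ ^ m := by rw [Multiset.map_const', Multiset.sum_replicate, nsmul_eq_mul]

/-- **`tr(Fᵐ | H^{2r}(X)) = t ∈ ℤ` with `|t − aᵣ · q^{rm}| ≤ (b_{2r} − aᵣ) · q^{rm}`** under the Riemann
hypothesis (`r ≤ d`, `m ≥ 1`, `aᵣ = dim K·Aʳ(X)`): among the `b_{2r}` reciprocal roots `α` of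
`P_{2r}(X, T)` (all of absolute value `qʳ`, Deligne 1974 Th. (1.6)) at least `aᵣ` are EQUAL to `qʳ` —
`dim K·Aʳ(X) ≤ mult_{q^{−r}} P_{2r}` (the tree's `finrank_algebraicClasses_le_rootMultiplicity_frobCharPoly`,
Milne 1986 Prop. 8.2) — so `tr(Fᵐ) = Σ αᵐ = aᵣ q^{rm} + Σ_{b_{2r} − aᵣ others} αᵐ` (Deligne 1974, proof of
(8.1): «La cohomologie de `X` est somme des `Q_ℓ·ηⁱ` … et de la partie primitive … `#X(𝔽_q) = Σ qⁱ +
(−1)ⁿ Σ αⱼ`»). [cite: Deligne1974, Th. (8.1) proof pp. 301–302 and Th. (1.6)]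
[cite: Milne1986ValuesZetaFunctionsFiniteFields, §8 Prop. 8.2] -/
theorem exists_int_frobTracePow_sub_le (hχ : ((χ (arithFrob k) : Kˣ) : K) = Nat.card k)
    (hX : IsSmoothProjective d X) (hRH : E.WeilRiemannHypothesisFor X d) {r : ℕ} (hr : r ≤ d)
    {m : ℕ} (hm : 0 < m) :
    ∃ t : ℤ, E.frobTracePow X (2 * r) m = (t : K) ∧
      |(t : ℝ) - Module.finrank K (E.algebraicClasses X r) * (Nat.card k : ℝ) ^ (r * m)| ≤
        ((Module.finrank K (E.obj X (2 * r)) : ℝ) - Module.finrank K (E.algebraicClasses X r)) *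
          (Nat.card k : ℝ) ^ (r * m) := by
  obtain ⟨m, rfl⟩ : ∃ j, m = j + 1 := ⟨m - 1, by omega⟩
  obtain ⟨P, hP, hroots⟩ := hRH
  set ι : Fin (2 * d + 1) := ⟨2 * r, by omega⟩ with hι
  have hPι : E.IsIntegralModel X (2 * r) (P ι) := hP ι
  have h0 : (P ι).coeff 0 = 1 := E.coeff_zero_eq_one_of_isIntegralModel hPι
  refine ⟨_, E.frobTracePow_succ_eq_intCast hX hPι m, ?_⟩
  have hq0 : (0 : ℝ) < Nat.card k := by exact_mod_cast Nat.card_pos (α := k)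
  set Pc : ℂ[X] := (P ι).map (Int.castRingHom ℂ) with hPc
  set a : ℕ := Module.finrank K (E.algebraicClasses X r) with ha
  set x : ℂ := (((Nat.card k : ℂ)) ^ r)⁻¹ with hx
  have hPc0 : Pc ≠ 0 := by
    have h1 : Pc.coeff 0 = 1 := by simp [hPc, h0]
    intro h
    rw [h, coeff_zero] at h1
    exact zero_ne_one h1
  -- (1) the integer trace is the power sum of the reciprocal roots in `ℂ`
  have hsum := intCast_coeff_logDerivInt_eq_sum_roots h0 m
  -- (2) the root `x = q^{−r}` of `P_{2r}` has multiplicity `≥ a`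
  have hmult : a ≤ Pc.roots.count x := by
    have h1 := E.finrank_algebraicClasses_le_rootMultiplicity_frobCharPoly hX r
    rw [coe_χ_geomFrob hχ, inv_pow] at h1
    have h2 := E.rootMultiplicity_map_eq_rootMultiplicity_frobCharPoly X hPι (((Nat.card k : ℚ) ^ r)⁻¹)
    rw [Rat.cast_inv, Rat.cast_pow, Rat.cast_natCast] at h2
    rw [← h2, eq_rootMultiplicity_map (algebraMap ℚ ℂ).injective (((Nat.card k : ℚ) ^ r)⁻¹),
      Polynomial.map_map, RingHom.ext_int ((algebraMap ℚ ℂ).comp (Int.castRingHom ℚ)) (Int.castRingHom ℂ),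
      map_inv₀, map_pow, map_natCast] at h1
    rwa [count_roots]
  -- (3) split off `a` copies of `x`
  obtain ⟨u, hu⟩ := Multiset.le_iff_exists_add.mp (Multiset.le_count_iff_replicate_le.mp hmult)
  have hcard : (Multiset.card u : ℝ) = (Module.finrank K (E.obj X (2 * r)) : ℝ) - a := by
    have h1 : Multiset.card Pc.roots = a + Multiset.card u := by
      rw [hu, Multiset.card_add, Multiset.card_replicate]
    have h2 : Multiset.card Pc.roots = Pc.natDegree := ((IsAlgClosed.splits Pc).natDegree_eq_card_roots).symm
    have h3 : Pc.natDegree = (P ι).natDegree :=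
      natDegree_map_eq_of_injective (Int.castRingHom ℂ).injective_int _
    have h4 := E.finrank_eq_natDegree_of_isIntegralModel hX hPι
    have h5 : ((Multiset.card u + a : ℕ) : ℝ) = Module.finrank K (E.obj X (2 * r)) := by
      exact_mod_cast (by omega : Multiset.card u + a = Module.finrank K (E.obj X (2 * r)))
    push_cast at h5
    linarith
  have hnorm : ∀ z ∈ u, ‖z‖ = ((Nat.card k : ℝ) ^ r)⁻¹ := by
    intro z hz
    have hz' : z ∈ Pc.roots := by rw [hu]; exact Multiset.mem_add.mpr (Or.inr hz)
    rw [hroots ι z ((mem_roots hPc0).mp hz'), hι]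
    rw [show (-(((2 * r : ℕ) : ℕ) : ℝ) / 2) = -(r : ℝ) by push_cast; ring, Real.rpow_neg hq0.le,
      Real.rpow_natCast]
  -- (4) `t − a q^{r(m+1)} = Σ_{z ∈ u} z^{−(m+1)}`
  have key : ((PowerSeries.coeff m (-(PowerSeries.invOfUnit ((P ι : ℤ[X]) : PowerSeries ℤ) 1 *
        (Polynomial.derivative (P ι) : PowerSeries ℤ))) : ℤ) : ℂ) -
        (a : ℂ) * (Nat.card k : ℂ) ^ (r * (m + 1)) = (u.map fun z => z⁻¹ ^ (m + 1)).sum := by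
    rw [hsum, ← hPc, hu, Multiset.map_add, Multiset.sum_add, Multiset.map_replicate,
      Multiset.sum_replicate, nsmul_eq_mul, hx, inv_inv, ← pow_mul]
    ring
  -- (5) norms
  have hbound := norm_multiset_sum_inv_pow_le hnorm (m + 1)
  rw [← key, hcard, ← pow_mul] at hbound
  have hcast : ((PowerSeries.coeff m (-(PowerSeries.invOfUnit ((P ι : ℤ[X]) : PowerSeries ℤ) 1 *
        (Polynomial.derivative (P ι) : PowerSeries ℤ))) : ℤ) : ℂ) -
        (a : ℂ) * (Nat.card k : ℂ) ^ (r * (m + 1)) =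
      ((((PowerSeries.coeff m (-(PowerSeries.invOfUnit ((P ι : ℤ[X]) : PowerSeries ℤ) 1 *
        (Polynomial.derivative (P ι) : PowerSeries ℤ))) : ℤ) : ℝ) -
        (a : ℝ) * (Nat.card k : ℝ) ^ (r * (m + 1)) : ℝ) : ℂ) := by
    push_cast
    ring
  rw [hcast, Complex.norm_real, Real.norm_eq_abs] at hbound
  exact hbound

/-! ### §3 Point counts: exact polynomial counts and Deligne's estimate (8.1) -/

section PointCounts

omit [Finite k] [CharZero K] in
/-- Splitting a sum over `0 ≤ i ≤ 2n` into even and odd indices. [folklore] -/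
private theorem sum_range_two_mul_add_one {M : Type*} [AddCommMonoid M] (g : ℕ → M) (n : ℕ) :
    ∑ i ∈ Finset.range (2 * n + 1), g i =
      ∑ r ∈ Finset.range (n + 1), g (2 * r) + ∑ r ∈ Finset.range n, g (2 * r + 1) := by
  induction n with
  | zero => simp
  | succ n ih =>
    rw [show 2 * (n + 1) + 1 = (2 * n + 1) + 1 + 1 by ring, Finset.sum_range_succ,
      Finset.sum_range_succ, ih, Finset.sum_range_succ (fun r => g (2 * r)) (n + 1),
      Finset.sum_range_succ (fun r => g (2 * r + 1)) n, show 2 * n + 1 + 1 = 2 * (n + 1) by ring]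
    abel

/-- The Lefschetz trace formula with even and odd degrees separated:
`#X(𝔽_{q^m}) = Σ_{r ≤ d} tr(Fᵐ | H^{2r}) − Σ_{r < d} tr(Fᵐ | H^{2r+1})`. [cite: Deligne1974, (1.5.1)] -/
theorem cast_pointCount_eq_sum_even_sub_sum_odd (hE : E.HasLefschetzTraceFormula)
    (hX : IsSmoothProjective d X) {m : ℕ} (hm : 0 < m) :
    (pointCount X m : K) =
      ∑ r ∈ Finset.range (d + 1), E.frobTracePow X (2 * r) m -
        ∑ r ∈ Finset.range d, E.frobTracePow X (2 * r + 1) m := by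
  rw [hE hX m hm, sum_range_two_mul_add_one (fun i => (-1 : K) ^ i * E.frobTracePow X i m) d,
    sub_eq_add_neg, ← Finset.sum_neg_distrib]
  congr 1
  · exact Finset.sum_congr rfl fun r _ => by rw [pow_mul, neg_one_sq, one_pow, one_mul]
  · exact Finset.sum_congr rfl fun r _ => by
      rw [pow_succ, pow_mul, neg_one_sq, one_pow, one_mul, neg_one_mul]

/-- Odd Betti number zero ⟹ the trace vanishes. [folklore] -/
private theorem frobTracePow_eq_zero_of_finrank_eq_zero (hX : IsSmoothProjective d X) {i : ℕ}
    (hi : Module.finrank K (E.obj X i) = 0) (m : ℕ) : E.frobTracePow X i m = 0 := by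
  haveI := E.finite_obj hX i
  haveI : Subsingleton (E.obj X i) := Module.finrank_zero_iff.mp hi
  rw [frobTracePow, Subsingleton.elim (E.frobAction X i ^ m) 0, map_zero]

/-- **Polynomial point counts (no Riemann hypothesis): `#X(𝔽_{q^m}) = Σ_{r=0}^{d} b_{2r} · q^{rm}`** when
every `H^{2r}(X)` (`r ≤ d`) is spanned by algebraic classes and every odd Betti number vanishes (e.g.
cellular varieties — Weil's test of his conjectures on Grassmannians, Kahn 2020 §3.3: «The case of
Grassmannian varieties now seems easy, insofar as they are cellular»; Deligne 1974, proof of (8.1)), for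
`E` with the Lefschetz trace formula and `χ(φ) = q`; in `K`. [cite: Deligne1974, Th. (8.1) proof pp. 301–302]
[cite: Kahn2020, §3.3 (Weil's conjectures and the Betti numbers; Grassmannians)] -/
theorem cast_pointCount_eq_sum_of_algebraic (hE : E.HasLefschetzTraceFormula)
    (hχ : ((χ (arithFrob k) : Kˣ) : K) = Nat.card k) (hX : IsSmoothProjective d X)
    (hodd : ∀ i ≤ 2 * d, Odd i → Module.finrank K (E.obj X i) = 0)
    (halg : ∀ r ≤ d, E.algebraicClasses X r = ⊤) {m : ℕ} (hm : 0 < m) :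
    (pointCount X m : K) =
      ∑ r ∈ Finset.range (d + 1), (Module.finrank K (E.obj X (2 * r)) : K) * (Nat.card k : K) ^ (r * m) := by
  rw [E.cast_pointCount_eq_sum_even_sub_sum_odd hE hX hm,
    Finset.sum_eq_zero fun r hr => E.frobTracePow_eq_zero_of_finrank_eq_zero hX
      (hodd (2 * r + 1) (by have := Finset.mem_range.mp hr; omega) (odd_two_mul_add_one r)) m,
    sub_zero]
  exact Finset.sum_congr rfl fun r hr =>
    E.frobTracePow_of_algebraicClasses_eq_top hχ hX (halg r (by have := Finset.mem_range.mp hr; omega)) m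

/-- **`#X(𝔽_{q^m}) = Σ_{r=0}^{d} b_{2r} · q^{rm}` in `ℕ`** under the same hypotheses (algebraic even
cohomology, no odd cohomology, trace formula, `χ(φ) = q`; NO Riemann hypothesis).
[cite: Deligne1974, Th. (8.1) proof pp. 301–302] [cite: Kahn2020, §3.3 (Grassmannians)] -/
theorem pointCount_eq_sum_of_algebraic (hE : E.HasLefschetzTraceFormula)
    (hχ : ((χ (arithFrob k) : Kˣ) : K) = Nat.card k) (hX : IsSmoothProjective d X)
    (hodd : ∀ i ≤ 2 * d, Odd i → Module.finrank K (E.obj X i) = 0)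
    (halg : ∀ r ≤ d, E.algebraicClasses X r = ⊤) {m : ℕ} (hm : 0 < m) :
    pointCount X m =
      ∑ r ∈ Finset.range (d + 1), Module.finrank K (E.obj X (2 * r)) * (Nat.card k) ^ (r * m) := by
  have h := E.cast_pointCount_eq_sum_of_algebraic hE hχ hX hodd halg hm
  exact_mod_cast h

/-- **Deligne's estimate (8.1), odd dimension `d`**: if `E` satisfies the trace formula, `χ(φ) = q` and the
Riemann hypothesis for `X`, every `H^{2r}(X)` (`r ≤ d`) is spanned by algebraic classes and the odd
cohomology off the middle degree vanishes, then for `m ≥ 1`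
**`|#X(𝔽_{q^m}) − Σ_{r=0}^{d} b_{2r} q^{rm}| ≤ b_d · q^{dm/2}`** («`|#X(𝔽_q) − #ℙⁿ(𝔽_q)| = |Σ αⱼ| ≤ b qⁿᐟ²`»,
`b = b′` for `n` odd). [cite: Deligne1974, Th. (8.1) pp. 301–302] -/
theorem abs_pointCount_sub_sum_le_of_odd (hE : E.HasLefschetzTraceFormula)
    (hχ : ((χ (arithFrob k) : Kˣ) : K) = Nat.card k) (hX : IsSmoothProjective d X) (hd : Odd d)
    (hRH : E.WeilRiemannHypothesisFor X d)
    (hodd : ∀ i ≤ 2 * d, Odd i → i ≠ d → Module.finrank K (E.obj X i) = 0)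
    (halg : ∀ r ≤ d, E.algebraicClasses X r = ⊤) {m : ℕ} (hm : 0 < m) :
    |(pointCount X m : ℝ) -
        ∑ r ∈ Finset.range (d + 1), (Module.finrank K (E.obj X (2 * r)) : ℝ) * (Nat.card k : ℝ) ^ (r * m)| ≤
      Module.finrank K (E.obj X d) * (Nat.card k : ℝ) ^ ((d : ℝ) * m / 2) := by
  obtain ⟨c, hc⟩ := hd
  obtain ⟨t, ht, htle⟩ := E.exists_int_frobTracePow_eq_abs_le hX hRH (i := d) (by omega) hm
  -- the point count in `K`: even part exact, odd part `= tr(Fᵐ | Hᵈ) = t`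
  set S : ℕ := ∑ r ∈ Finset.range (d + 1), Module.finrank K (E.obj X (2 * r)) * (Nat.card k) ^ (r * m)
    with hS
  have hK : (pointCount X m : K) = (S : K) - (t : K) := by
    rw [E.cast_pointCount_eq_sum_even_sub_sum_odd hE hX hm, hS]
    push_cast
    congr 1
    · exact Finset.sum_congr rfl fun r hr =>
        E.frobTracePow_of_algebraicClasses_eq_top hχ hX (halg r (by have := Finset.mem_range.mp hr; omega)) m
    · rw [Finset.sum_eq_single c, show 2 * c + 1 = d by omega, ht]
      · intro r hr hrc
        exact E.frobTracePow_eq_zero_of_finrank_eq_zero hX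
          (hodd (2 * r + 1) (by have := Finset.mem_range.mp hr; omega) (odd_two_mul_add_one r) (by omega)) m
      · intro h; exact absurd (Finset.mem_range.mpr (by omega)) h
  have hZ : (pointCount X m : ℤ) = (S : ℤ) - t := by
    have h : ((pointCount X m : ℤ) : K) = (((S : ℤ) - t : ℤ) : K) := by push_cast; exact_mod_cast hK
    exact Int.cast_injective h
  have hR : (pointCount X m : ℝ) - (S : ℝ) = -(t : ℝ) := by
    have h := congrArg (fun z : ℤ => (z : ℝ)) hZ
    push_cast at h
    linarith
  rw [hS] at hR
  push_cast at hR
  rw [hR, abs_neg]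
  exact htle

/-- **Deligne's estimate (8.1), even dimension `2c`**: if `E` satisfies the trace formula, `χ(φ) = q` and
the Riemann hypothesis for `X` (`dim X = 2c`), the odd cohomology vanishes and every `H^{2r}(X)` with
`r ≠ c` is spanned by algebraic classes, then for `m ≥ 1`, with `a_c = dim K·A^c(X)`,
**`|#X(𝔽_{q^m}) − Σ_{r ≤ 2c, r ≠ c} b_{2r} q^{rm} − a_c q^{cm}| ≤ (b_{2c} − a_c) · q^{cm}`** (Deligne's
`b = b′ − 1` is the case `a_c = 1` of the hyperplane-power line `Q_ℓ·η^c`; here all middle algebraic classes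
are split off). [cite: Deligne1974, Th. (8.1) pp. 301–302] [cite: Milne1986ValuesZetaFunctionsFiniteFields, §8 Prop. 8.2] -/
theorem abs_pointCount_sub_sum_le_of_even (hE : E.HasLefschetzTraceFormula)
    (hχ : ((χ (arithFrob k) : Kˣ) : K) = Nat.card k) {c : ℕ} (hX : IsSmoothProjective (2 * c) X)
    (hRH : E.WeilRiemannHypothesisFor X (2 * c))
    (hodd : ∀ i ≤ 2 * (2 * c), Odd i → Module.finrank K (E.obj X i) = 0)
    (halg : ∀ r ≤ 2 * c, r ≠ c → E.algebraicClasses X r = ⊤) {m : ℕ} (hm : 0 < m) :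
    |(pointCount X m : ℝ) -
        ∑ r ∈ (Finset.range (2 * c + 1)).erase c,
          (Module.finrank K (E.obj X (2 * r)) : ℝ) * (Nat.card k : ℝ) ^ (r * m) -
        Module.finrank K (E.algebraicClasses X c) * (Nat.card k : ℝ) ^ (c * m)| ≤
      ((Module.finrank K (E.obj X (2 * c)) : ℝ) - Module.finrank K (E.algebraicClasses X c)) *
        (Nat.card k : ℝ) ^ (c * m) := by
  obtain ⟨t, ht, htle⟩ := E.exists_int_frobTracePow_sub_le hχ hX hRH (r := c) (by omega) hm
  set S : ℕ := ∑ r ∈ (Finset.range (2 * c + 1)).erase c,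
    Module.finrank K (E.obj X (2 * r)) * (Nat.card k) ^ (r * m) with hS
  have hK : (pointCount X m : K) = (S : K) + (t : K) := by
    rw [E.cast_pointCount_eq_sum_even_sub_sum_odd hE hX hm, hS,
      Finset.sum_eq_zero fun r hr => E.frobTracePow_eq_zero_of_finrank_eq_zero hX
        (hodd (2 * r + 1) (by have := Finset.mem_range.mp hr; omega) (odd_two_mul_add_one r)) m,
      sub_zero, ← Finset.add_sum_erase _ _ (Finset.mem_range.mpr (by omega : c < 2 * c + 1)), ht,
      add_comm]
    push_cast
    congr 1
    exact Finset.sum_congr rfl fun r hr => by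
      obtain ⟨hrc, hr'⟩ := Finset.mem_erase.mp hr
      exact E.frobTracePow_of_algebraicClasses_eq_top hχ hX
        (halg r (by have := Finset.mem_range.mp hr'; omega) hrc) m
  have hZ : (pointCount X m : ℤ) = (S : ℤ) + t := by
    have h : ((pointCount X m : ℤ) : K) = (((S : ℤ) + t : ℤ) : K) := by push_cast; exact_mod_cast hK
    exact Int.cast_injective h
  have hR : (pointCount X m : ℝ) - (S : ℝ) = (t : ℝ) := by
    have h := congrArg (fun z : ℤ => (z : ℝ)) hZ
    push_cast at h
    linarith
  rw [hS] at hR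
  push_cast at hR
  rw [hR]
  exact htle

end PointCounts

end GaloisWeilCohomology

end Literature.AlgebraicGeometry.Motives
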